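import Mathlib
import Summits.Ventures.PercRepro2.Defs
import Summits.Ventures.PercRepro2.Graph
import Summits.Ventures.PercRepro2.Harris
import Summits.Ventures.PercRepro2.Events
import Summits.Ventures.PercRepro2.Independence
import Summits.Ventures.PercRepro2.Induced
import Summits.Ventures.PercRepro2.HullTree
import Summits.Ventures.PercRepro2.SideCluster
import Summits.Ventures.PercRepro2.GateDefs
import Summits.Ventures.PercRepro2.GateAnatomy
import Summits.Ventures.PercRepro2.GateCylinder
import Summits.Ventures.PercRepro2.GateForest
import Summits.Ventures.PercRepro2.GateSplit
import Summits.Ventures.PercRepro2.GateSplitForest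
import Summits.Ventures.PercRepro2.ForestCluster
import Summits.Ventures.PercRepro2.GateForestPaths

/-!
# Row 2′CON-W on every forest: `(GATE A,B)` for all gate sets, unconditionally (blind cell
PercRepro2, mine-c g8; proofs/MINEC-LSMGATE.md §10, §13)

For the general gate `Gate.GateRow s {t} a b A B` the open content is the class
`A₂ = {C(t) hits B} ∩ {s ↮ {t} ∪ A}` (`GateSplit`), and `GateSplitForest.gateRow_of_massA₂_logSupermod`
closes the gate from the FKG lattice condition on the root-frame mass `massA₂ W = P(C(s) = W ∧ A₂)`.
On a forest this mass FACTORISES: `{C(t) hits B}` is the union of the cylinders of the `t–b` paths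
(`hitCyl`), on `{C(s) = W}` only the paths AVOIDING `W` can be open (`clusterEvent_inter_hitsUW`),
those cylinders depend on edges not touching `W` (independence, `massA₂_eq`), so
`massA₂ W = P(C(s) = W) · 1[W avoids {t} ∪ A] · F(avoidB W)` with `F(S) = P(⋃_{b ∈ S} hitCyl b)`.
The cluster law is log-modular on rooted subtrees (`ForestCluster`), the avoidance indicators are
modular, `F` is monotone, and the avoidance sets of two rooted subtrees are NESTED
(`avoidB_nested`: a path meeting `W₂` but not `W₁` and a path meeting `W₁` but not `W₂` would
produce a cross edge, `ForestCluster.no_cross_edge`) — whence the lattice condition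
(`massA₂LogSupermod_of_isForest`) and **`gateRow_of_isForest`**: `Hull.IsForest ends → IsProbVec p →
Gate.GateRow p ends s {t} a b A B` for every `s, t, a, b, A, B`.
-/

namespace Summit.Ventures.PercRepro2

namespace GateForestGeneral

open scoped Classical
open GateForestPaths

variable {V : Type*} {E : Type*} [Fintype E] [Fintype V]

variable {ends : E → Sym2 V} {t : V} {B : Finset V}

variable {R : Type*} [Field R] [LinearOrder R] [IsStrictOrderedRing R]

omit [LinearOrder R] [IsStrictOrderedRing R] in
/-- The class-`A₂` mass of a rooted subtree factorises through the cluster law. -/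
theorem massA₂_eq (p : E → R) (hF : Hull.IsForest ends) (s : V) (A : Finset V) {W : Finset V}
    (hW : ForestCluster.IsRootedSub ends s W) :
    GateSplit.massA₂ p ends s t A B W =
      clusterMass p ends s W * prob p (hitAvoid ends t B W) *
        (if t ∉ W ∧ ∀ x ∈ A, x ∉ W then 1 else 0) := by
  unfold GateSplit.massA₂ GateSplit.classA₂ clusterMass
  by_cases hav : t ∉ W ∧ ∀ x ∈ A, x ∉ W
  · rw [if_pos hav, mul_one]
    have e1 : clusterEvent ends s (↑W : Set V) ∩ (GateSplit.hitsUW ends t B ∩ avoidAll ends s ({t} ∪ A)) =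
        clusterEvent ends s (↑W : Set V) ∩ GateSplit.hitsUW ends t B := by
      ext ω
      simp only [Set.mem_inter_iff, and_congr_right_iff]
      intro hW'
      constructor
      · rintro ⟨h1, _⟩; exact h1
      · intro h1
        refine ⟨h1, ?_⟩
        intro x hx hc
        have : x ∈ cluster ends ω s := hc
        rw [mem_clusterEvent.1 hW'] at this
        rcases Finset.mem_union.1 hx with hx | hx
        · rw [Finset.mem_singleton] at hx
          subst hx
          exact hav.1 this
        · exact hav.2 x hx this
    rw [e1, clusterEvent_inter_hitsUW hF s hav.1, ForestCluster.clusterEvent_eq_subtreeCyl hF hW]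
    refine prob_inter_eq_mul_of_dependsOn p (F₁ := touches ends (↑W : Set V))
      (F₂ := (touches ends (↑W : Set V))ᶜ) disjoint_compl_right ?_ (dependsOn_hitAvoid ends t B W)
    -- `subtreeCyl W` depends on the edges touching `W`
    intro ω ω' h
    simp only [ForestCluster.subtreeCyl, Set.mem_setOf_eq]
    refine propext (and_congr (forall_congr' fun e => forall_congr' fun he => forall_congr' fun _ => ?_)
      (forall_congr' fun e => forall_congr' fun he => ?_))
    · obtain ⟨x, hx, y, _, hxy⟩ := he
      rw [h e ⟨x, hx, y, hxy⟩]
    · obtain ⟨x, hx, y, _, hxy⟩ := he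
      rw [h e ⟨x, hx, y, hxy⟩]
  · rw [if_neg hav, mul_zero]
    have : clusterEvent ends s (↑W : Set V) ∩ (GateSplit.hitsUW ends t B ∩ avoidAll ends s ({t} ∪ A)) = ∅ := by
      ext ω
      simp only [Set.mem_inter_iff, Set.mem_empty_iff_false, iff_false, not_and]
      intro hW' _ hav'
      apply hav
      refine ⟨fun htW => hav' t (by simp) ?_, fun x hx hxW => hav' x (by simp [hx]) ?_⟩
      · show t ∈ cluster ends ω s
        rw [mem_clusterEvent.1 hW']; exact htW
      · show x ∈ cluster ends ω s
        rw [mem_clusterEvent.1 hW']; exact hxW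
    rw [this]
    simp [prob]

/-! ## The lattice condition and the theorem -/

/-- `hitAvoid` masses are ordered by the avoidance sets. -/
lemma prob_hitAvoid_le (p : E → R) (hp : IsProbVec p) {W₁ W₂ : Finset V}
    (h : avoidB ends t B W₁ ⊆ avoidB ends t B W₂) :
    prob p (hitAvoid ends t B W₁) ≤ prob p (hitAvoid ends t B W₂) :=
  prob_mono hp (hitAvoid_mono ends t B h)

/-- **The FKG lattice condition for the class-`A₂` mass holds on every forest.** -/
theorem massA₂LogSupermod_of_isForest (p : E → R) (hp : IsProbVec p) (hF : Hull.IsForest ends)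
    (s : V) (A : Finset V) : GateSplit.MassA₂LogSupermod p ends s t A B := by
  intro W₁ W₂
  by_cases h₁ : ForestCluster.IsRootedSub ends s W₁
  · by_cases h₂ : ForestCluster.IsRootedSub ends s W₂
    · rw [massA₂_eq p hF s A h₁, massA₂_eq p hF s A h₂,
        massA₂_eq p hF s A (ForestCluster.inter_rooted hF h₁ h₂),
        massA₂_eq p hF s A (ForestCluster.union_rooted h₁ h₂)]
      -- the cluster masses are modular
      have hν := ForestCluster.clusterMass_mul_eq p hF h₁ h₂
      -- the indicators are log-supermodular
      have hind : (if t ∉ W₁ ∧ ∀ x ∈ A, x ∉ W₁ then (1 : R) else 0) *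
          (if t ∉ W₂ ∧ ∀ x ∈ A, x ∉ W₂ then (1 : R) else 0) ≤
          (if t ∉ W₁ ∩ W₂ ∧ ∀ x ∈ A, x ∉ W₁ ∩ W₂ then (1 : R) else 0) *
          (if t ∉ W₁ ∪ W₂ ∧ ∀ x ∈ A, x ∉ W₁ ∪ W₂ then (1 : R) else 0) := by
        by_cases c₁ : t ∉ W₁ ∧ ∀ x ∈ A, x ∉ W₁
        · by_cases c₂ : t ∉ W₂ ∧ ∀ x ∈ A, x ∉ W₂
          · have cu : t ∉ W₁ ∪ W₂ ∧ ∀ x ∈ A, x ∉ W₁ ∪ W₂ := by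
              refine ⟨fun h => ?_, fun x hx h => ?_⟩
              · rcases Finset.mem_union.1 h with h | h
                · exact c₁.1 h
                · exact c₂.1 h
              · rcases Finset.mem_union.1 h with h | h
                · exact c₁.2 x hx h
                · exact c₂.2 x hx h
            have ci : t ∉ W₁ ∩ W₂ ∧ ∀ x ∈ A, x ∉ W₁ ∩ W₂ :=
              ⟨fun h => c₁.1 (Finset.mem_inter.1 h).1, fun x hx h => c₁.2 x hx (Finset.mem_inter.1 h).1⟩
            rw [if_pos c₁, if_pos c₂, if_pos cu, if_pos ci]
          · rw [if_neg c₂, mul_zero]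
            exact mul_nonneg (by split_ifs <;> norm_num) (by split_ifs <;> norm_num)
        · rw [if_neg c₁, zero_mul]
          exact mul_nonneg (by split_ifs <;> norm_num) (by split_ifs <;> norm_num)
      -- the hit masses: nested avoidance sets
      have hF₁ : prob p (hitAvoid ends t B W₁) * prob p (hitAvoid ends t B W₂) ≤
          prob p (hitAvoid ends t B (W₁ ∩ W₂)) * prob p (hitAvoid ends t B (W₁ ∪ W₂)) := by
        have hm0 : ∀ W, 0 ≤ prob p (hitAvoid ends t B W) := fun W => prob_nonneg hp _
        have hu : avoidB ends t B (W₁ ∪ W₂) = avoidB ends t B W₁ ∩ avoidB ends t B W₂ :=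
          avoidB_union ends t B W₁ W₂
        have hi := avoidB_inter_supset ends t B W₁ W₂
        rcases avoidB_nested (B := B) (t := t) hF h₁ h₂ with hn | hn
        · -- `avoidB W₁ ⊆ avoidB W₂`: union set = avoidB W₁, intersection set ⊇ avoidB W₂
          have e₁ : avoidB ends t B (W₁ ∪ W₂) = avoidB ends t B W₁ := by
            rw [hu]; exact Finset.inter_eq_left.2 hn
          have h₂' : avoidB ends t B W₂ ⊆ avoidB ends t B (W₁ ∩ W₂) :=
            Finset.union_subset_iff.1 hi |>.2
          have l₁ : prob p (hitAvoid ends t B W₁) ≤ prob p (hitAvoid ends t B (W₁ ∪ W₂)) :=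
            prob_hitAvoid_le p hp (by rw [e₁])
          have l₂ : prob p (hitAvoid ends t B W₂) ≤ prob p (hitAvoid ends t B (W₁ ∩ W₂)) :=
            prob_hitAvoid_le p hp h₂'
          calc prob p (hitAvoid ends t B W₁) * prob p (hitAvoid ends t B W₂)
              ≤ prob p (hitAvoid ends t B (W₁ ∪ W₂)) * prob p (hitAvoid ends t B (W₁ ∩ W₂)) :=
                mul_le_mul l₁ l₂ (hm0 _) (hm0 _)
            _ = _ := mul_comm _ _
        · have e₁ : avoidB ends t B (W₁ ∪ W₂) = avoidB ends t B W₂ := by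
            rw [hu]; exact Finset.inter_eq_right.2 hn
          have h₁' : avoidB ends t B W₁ ⊆ avoidB ends t B (W₁ ∩ W₂) :=
            Finset.union_subset_iff.1 hi |>.1
          have l₁ : prob p (hitAvoid ends t B W₁) ≤ prob p (hitAvoid ends t B (W₁ ∩ W₂)) :=
            prob_hitAvoid_le p hp h₁'
          have l₂ : prob p (hitAvoid ends t B W₂) ≤ prob p (hitAvoid ends t B (W₁ ∪ W₂)) :=
            prob_hitAvoid_le p hp (by rw [e₁])
          exact mul_le_mul l₁ l₂ (hm0 _) (hm0 _)
      have hν0 : ∀ W, 0 ≤ clusterMass p ends s W := fun W => prob_nonneg hp _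
      have hi0 : ∀ (c : Prop) [Decidable c], (0 : R) ≤ if c then 1 else 0 := fun c _ => by
        split_ifs <;> norm_num
      -- assemble: ν₁ν₂ · F₁F₂ · i₁i₂ ≤ ν∩ν∪ · F∩F∪ · i∩i∪
      calc clusterMass p ends s W₁ * prob p (hitAvoid ends t B W₁) *
            (if t ∉ W₁ ∧ ∀ x ∈ A, x ∉ W₁ then (1 : R) else 0) *
          (clusterMass p ends s W₂ * prob p (hitAvoid ends t B W₂) *
            (if t ∉ W₂ ∧ ∀ x ∈ A, x ∉ W₂ then (1 : R) else 0))
          = (clusterMass p ends s W₁ * clusterMass p ends s W₂) *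
              (prob p (hitAvoid ends t B W₁) * prob p (hitAvoid ends t B W₂)) *
              ((if t ∉ W₁ ∧ ∀ x ∈ A, x ∉ W₁ then (1 : R) else 0) *
                (if t ∉ W₂ ∧ ∀ x ∈ A, x ∉ W₂ then (1 : R) else 0)) := by ring
        _ ≤ (clusterMass p ends s (W₁ ∩ W₂) * clusterMass p ends s (W₁ ∪ W₂)) *
              (prob p (hitAvoid ends t B (W₁ ∩ W₂)) * prob p (hitAvoid ends t B (W₁ ∪ W₂))) *
              ((if t ∉ W₁ ∩ W₂ ∧ ∀ x ∈ A, x ∉ W₁ ∩ W₂ then (1 : R) else 0) *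
                (if t ∉ W₁ ∪ W₂ ∧ ∀ x ∈ A, x ∉ W₁ ∪ W₂ then (1 : R) else 0)) := by
            rw [hν]
            refine mul_le_mul (mul_le_mul_of_nonneg_left hF₁ (mul_nonneg (hν0 _) (hν0 _))) hind
              (mul_nonneg (hi0 _) (hi0 _)) ?_
            exact mul_nonneg (mul_nonneg (hν0 _) (hν0 _))
              (mul_nonneg (prob_nonneg hp _) (prob_nonneg hp _))
        _ = _ := by ring
    · have : GateSplit.massA₂ p ends s t A B W₂ = 0 := by
        unfold GateSplit.massA₂
        have : clusterEvent ends s (↑W₂ : Set V) = ∅ := by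
          ext ω
          simp only [Set.mem_empty_iff_false, iff_false]
          exact fun h => h₂ (ForestCluster.isRootedSub_of_clusterEvent h)
        rw [this]; simp [prob]
      rw [this, mul_zero]
      exact mul_nonneg (prob_nonneg hp _) (prob_nonneg hp _)
  · have : GateSplit.massA₂ p ends s t A B W₁ = 0 := by
      unfold GateSplit.massA₂
      have : clusterEvent ends s (↑W₁ : Set V) = ∅ := by
        ext ω
        simp only [Set.mem_empty_iff_false, iff_false]
        exact fun h => h₁ (ForestCluster.isRootedSub_of_clusterEvent h)
      rw [this]; simp [prob]
    rw [this, zero_mul]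
    exact mul_nonneg (prob_nonneg hp _) (prob_nonneg hp _)

/-- **Row 2′CON-W on every forest** (`|T| = 1`, unconditional): for a forest `ends`, admissible
weights, every root `s`, avoided vertex `t`, markers `a, b` and gate sets `A, B`,
`Gate.GateRow s {t} a b A B`. -/
theorem gateRow_of_isForest (p : E → R) (hp : IsProbVec p) (hF : Hull.IsForest ends)
    (s a b : V) (A : Finset V) : Gate.GateRow p ends s {t} a b A B :=
  GateSplitForest.gateRow_of_massA₂_logSupermod p ends s t a b A B hp
    (massA₂LogSupermod_of_isForest p hp hF s A)

end GateForestGeneral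

end Summit.Ventures.PercRepro2
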